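import Mathlib
import Literature.RepresentationTheory.FiniteGroups.CharacterDegrees
import Literature.RepresentationTheory.FiniteGroups.IrreducibleCharacters
import Summits.MatrixMultiplication.MatrixMultiplication.Theorems.LevelGradedCohnUmansGradedDesignFamilyStubBlockContainment
import Summits.MatrixMultiplication.MatrixMultiplication.Theorems.LevelGradedCohnUmansGradedDesignFamilyStubFrameStructure

/-!
# The level-one host `(GL₂(K), F₁(K))` over an arbitrary finite field: bi-invariance, budget,
# one-subgroup test (crux `LevelGradedCohnUmans.GradedDesignFamily`, stmt-MatrixMultiplication-7610;
# line `quadratic-extension-level-one-cell`, lead c5 — part 1 of the line's landed reduction)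

The line `quadratic-extension-level-one-cell` of the crux `GradedDesignFamily` is CLOSED MODULO ONE
registered stub, `stub_subfieldCell` (S3).  Its two structure stubs are landed
(`stub_blockContainment` p120556, `stub_frameStructure` p120581); the composition S3 ⟹ crux lived
only in the crux workfile `Cruxes/GradedDesignFamily/Lines/quadratic_extension_level_one_cell.lean`.
This file and its sequel `…GradedDesignFamilyOfSubfieldCell.lean` land it, with the level-one test
space written as an explicit span (no new definitions).  Here, for every finite field `K`
(`Q = |K|`) and `F₁(K) := span{g ↦ Σ_u c u (g·u)} ≤ ℂ^{GL₂(K)}`: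

* `frame_transl`, `frameSpan_biInv` — `F₁(K)` is BI-INVARIANT (reindex `u ↦ b u`): the crux's
  first clause for the host, verbatim;
* `exists_coeff_of_mem_frameSpan` — every element of the span is a frame function;
* `finrank_frameSpan_le`, `frameBudget_le`, `frameBudget_le_pow` (registered) — from S1 + S2:
  `dim F₁ ≤ Q³ + Q²`, every irreducible character in `F₁` has degree `≤ Q + 1`, hence
  `Σ_{χ ∈ Irr(GL₂ K) ∩ F₁(K)} χ(1)^s ≤ (Q+1)^{s−2}(Q³+Q²) ≤ 2^s Q^{1+s}` for `s ≥ 2`;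
* `frameSeparated_image` — the ONE-SUBGROUP IDENTITY TEST: for an injective hom
  `φ : SL₂(k) →* GL₂(K)`, frame separators for the targets `(1, z₀)` on `φ(SL₂ k) × Y × Y × Z` give
  frame separators for every target `(φ a₀, z₀)` by left translation (S3's form of level-one
  separation loses nothing).

[cite: BlasiakCohnGrochowPrattUmans2024 Def 2.1/Thm 2.2 (frame / permutation-module form of the
level-one test space); CohnUmans2003 Prop 11]
-/

set_option linter.dupNamespace false

noncomputable section

open scoped BigOperators
open Literature.RepresentationTheory.FiniteGroups

namespace Summit.MatrixMultiplication.MatrixMultiplication.Theorems.GradedDesignFamily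

namespace SubfieldCell

/-! ## The level-one host `(GL₂(K), F₁(K))` over an arbitrary finite field -/

section Host

variable {K : Type} [Field K] [Fintype K]

omit [Fintype K] in
/-- `u ↦ b·u` is a bijection of `K²` for `b ∈ GL₂(K)`. [folklore] -/
theorem mulVec_bijective (b : Matrix.GeneralLinearGroup (Fin 2) K) :
    Function.Bijective fun u : Fin 2 → K => (b : Matrix (Fin 2) (Fin 2) K).mulVec u := by
  refine Function.bijective_iff_has_inverse.2
    ⟨fun u => ((b⁻¹ : Matrix.GeneralLinearGroup (Fin 2) K) : Matrix (Fin 2) (Fin 2) K).mulVec u,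
      fun u => ?_, fun u => ?_⟩
  · simp only [Matrix.mulVec_mulVec]
    rw [← Units.val_mul, inv_mul_cancel, Units.val_one, Matrix.one_mulVec]
  · simp only [Matrix.mulVec_mulVec]
    rw [← Units.val_mul, mul_inv_cancel, Units.val_one, Matrix.one_mulVec]

/-- **Bi-invariance by reindexing**: the two-sided translate `g ↦ F_c(a g b)` of the frame function
with table `c` is the frame function of the table `(u, v) ↦ c (b⁻¹u) (a v)` (substitute `u ↦ b u`).
[folklore] -/
theorem frame_transl (c : (Fin 2 → K) → (Fin 2 → K) → ℂ)
    (a b g : Matrix.GeneralLinearGroup (Fin 2) K) :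
    (∑ u : Fin 2 → K, c u (((a * g * b : Matrix.GeneralLinearGroup (Fin 2) K) :
        Matrix (Fin 2) (Fin 2) K).mulVec u)) =
      ∑ u : Fin 2 → K, (fun u v => c (((b⁻¹ : Matrix.GeneralLinearGroup (Fin 2) K) :
          Matrix (Fin 2) (Fin 2) K).mulVec u) ((a : Matrix (Fin 2) (Fin 2) K).mulVec v)) u
        ((g : Matrix (Fin 2) (Fin 2) K).mulVec u) := by
  refine Fintype.sum_bijective _ (mulVec_bijective b) _ _ fun u => ?_
  have hu : ((b⁻¹ : Matrix.GeneralLinearGroup (Fin 2) K) : Matrix (Fin 2) (Fin 2) K).mulVec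
      ((b : Matrix (Fin 2) (Fin 2) K).mulVec u) = u := by
    simp only [Matrix.mulVec_mulVec]
    rw [← Units.val_mul, inv_mul_cancel, Units.val_one, Matrix.one_mulVec]
  simp only [hu, Matrix.mulVec_mulVec, ← Units.val_mul, mul_assoc]

variable (K)

/-- The level-one ("frame") test space `F₁(K)` of `GL₂(K)`, as the span of the frame functions
`g ↦ Σ_u c u (g·u)`, is BI-INVARIANT — the crux's first clause, verbatim. [folklore] -/
theorem frameSpan_biInv :
    ∀ f ∈ Submodule.span ℂ {f : Matrix.GeneralLinearGroup (Fin 2) K → ℂ |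
        ∃ c : (Fin 2 → K) → (Fin 2 → K) → ℂ, f = fun g : Matrix.GeneralLinearGroup (Fin 2) K =>
          ∑ u : Fin 2 → K, c u ((g : Matrix (Fin 2) (Fin 2) K).mulVec u)},
      ∀ a b : Matrix.GeneralLinearGroup (Fin 2) K,
        (fun g : Matrix.GeneralLinearGroup (Fin 2) K => f (a * g * b)) ∈
          Submodule.span ℂ {f : Matrix.GeneralLinearGroup (Fin 2) K → ℂ |
            ∃ c : (Fin 2 → K) → (Fin 2 → K) → ℂ, f = fun g : Matrix.GeneralLinearGroup (Fin 2) K =>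
              ∑ u : Fin 2 → K, c u ((g : Matrix (Fin 2) (Fin 2) K).mulVec u)} := by
  intro f hf a b
  induction hf using Submodule.span_induction with
  | mem f hf =>
      obtain ⟨c, rfl⟩ := hf
      refine Submodule.subset_span
        ⟨fun u v => c (((b⁻¹ : Matrix.GeneralLinearGroup (Fin 2) K) :
            Matrix (Fin 2) (Fin 2) K).mulVec u) ((a : Matrix (Fin 2) (Fin 2) K).mulVec v),
          funext fun g => ?_⟩
      exact frame_transl c a b g
  | zero => exact Submodule.zero_mem _
  | add f₁ f₂ _ _ h₁ h₂ => exact Submodule.add_mem _ h₁ h₂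
  | smul r f _ h => exact Submodule.smul_mem _ r h

/-- Every element of the frame span IS a frame function (the frame functions form a subspace).
[folklore] -/
theorem exists_coeff_of_mem_frameSpan {f : Matrix.GeneralLinearGroup (Fin 2) K → ℂ}
    (hf : f ∈ Submodule.span ℂ {f : Matrix.GeneralLinearGroup (Fin 2) K → ℂ |
        ∃ c : (Fin 2 → K) → (Fin 2 → K) → ℂ, f = fun g : Matrix.GeneralLinearGroup (Fin 2) K =>
          ∑ u : Fin 2 → K, c u ((g : Matrix (Fin 2) (Fin 2) K).mulVec u)}) :
    ∃ c : (Fin 2 → K) → (Fin 2 → K) → ℂ, ∀ g : Matrix.GeneralLinearGroup (Fin 2) K,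
      f g = ∑ u : Fin 2 → K, c u ((g : Matrix (Fin 2) (Fin 2) K).mulVec u) := by
  induction hf using Submodule.span_induction with
  | mem f hf =>
      obtain ⟨c, rfl⟩ := hf
      exact ⟨c, fun g => rfl⟩
  | zero => exact ⟨fun _ _ => 0, fun g => by simp⟩
  | add f₁ f₂ _ _ h₁ h₂ =>
      obtain ⟨c₁, hc₁⟩ := h₁
      obtain ⟨c₂, hc₂⟩ := h₂
      refine ⟨fun u v => c₁ u v + c₂ u v, fun g => ?_⟩
      simp only [Pi.add_apply, hc₁ g, hc₂ g, Finset.sum_add_distrib]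
  | smul r f _ h =>
      obtain ⟨c, hc⟩ := h
      refine ⟨fun u v => r * c u v, fun g => ?_⟩
      simp only [Pi.smul_apply, smul_eq_mul, hc g, Finset.mul_sum]

variable [DecidableEq K]

/-- `dim F₁(K) ≤ Q³ + Q²` (from the landed S2 (i): a spanning set of that size). [folklore] -/
theorem finrank_frameSpan_le :
    (Module.finrank ℂ (Submodule.span ℂ {f : Matrix.GeneralLinearGroup (Fin 2) K → ℂ |
        ∃ c : (Fin 2 → K) → (Fin 2 → K) → ℂ, f = fun g : Matrix.GeneralLinearGroup (Fin 2) K =>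
          ∑ u : Fin 2 → K, c u ((g : Matrix (Fin 2) (Fin 2) K).mulVec u)}) : ℝ) ≤
      (Fintype.card K : ℝ) ^ 3 + (Fintype.card K : ℝ) ^ 2 := by
  obtain ⟨⟨B, hB, hspan⟩, -⟩ := stub_frameStructure K
  have hle : Submodule.span ℂ {f : Matrix.GeneralLinearGroup (Fin 2) K → ℂ |
        ∃ c : (Fin 2 → K) → (Fin 2 → K) → ℂ, f = fun g : Matrix.GeneralLinearGroup (Fin 2) K =>
          ∑ u : Fin 2 → K, c u ((g : Matrix (Fin 2) (Fin 2) K).mulVec u)} ≤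
      Submodule.span ℂ (B : Set (Matrix.GeneralLinearGroup (Fin 2) K → ℂ)) := by
    refine Submodule.span_le.2 ?_
    rintro f ⟨c, rfl⟩
    exact hspan c
  have h1 : Module.finrank ℂ (Submodule.span ℂ {f : Matrix.GeneralLinearGroup (Fin 2) K → ℂ |
        ∃ c : (Fin 2 → K) → (Fin 2 → K) → ℂ, f = fun g : Matrix.GeneralLinearGroup (Fin 2) K =>
          ∑ u : Fin 2 → K, c u ((g : Matrix (Fin 2) (Fin 2) K).mulVec u)}) ≤ B.card :=
    (Submodule.finrank_mono hle).trans (finrank_span_finset_le_card B)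
  exact_mod_cast h1.trans hB

/-- **The level-one budget over any finite field** (S1 + S2): for `s ≥ 2`,
`Σ_{χ ∈ Irr(GL₂ K) ∩ F₁(K)} χ(1)^s ≤ (Q+1)^{s−2} · (Q³ + Q²)`. [folklore] -/
theorem frameBudget_le (s : ℝ) (hs : 2 ≤ s) :
    (∑ᶠ χ ∈ irrChars (Matrix.GeneralLinearGroup (Fin 2) K) ∩
        ((Submodule.span ℂ {f : Matrix.GeneralLinearGroup (Fin 2) K → ℂ |
          ∃ c : (Fin 2 → K) → (Fin 2 → K) → ℂ, f = fun g : Matrix.GeneralLinearGroup (Fin 2) K =>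
            ∑ u : Fin 2 → K, c u ((g : Matrix (Fin 2) (Fin 2) K).mulVec u)} :
              Submodule ℂ (Matrix.GeneralLinearGroup (Fin 2) K → ℂ)) :
          Set (Matrix.GeneralLinearGroup (Fin 2) K → ℂ)), (χ 1).re ^ s) ≤
      ((Fintype.card K : ℝ) + 1) ^ (s - 2) *
        ((Fintype.card K : ℝ) ^ 3 + (Fintype.card K : ℝ) ^ 2) := by
  set J : Submodule ℂ (Matrix.GeneralLinearGroup (Fin 2) K → ℂ) :=
    Submodule.span ℂ {f : Matrix.GeneralLinearGroup (Fin 2) K → ℂ |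
      ∃ c : (Fin 2 → K) → (Fin 2 → K) → ℂ, f = fun g : Matrix.GeneralLinearGroup (Fin 2) K =>
        ∑ u : Fin 2 → K, c u ((g : Matrix (Fin 2) (Fin 2) K).mulVec u)} with hJ_def
  set Q : ℝ := (Fintype.card K : ℝ) with hQ
  have hQ0 : 0 ≤ Q := by positivity
  have hfin : (irrChars (Matrix.GeneralLinearGroup (Fin 2) K) ∩
      (J : Set (Matrix.GeneralLinearGroup (Fin 2) K → ℂ))).Finite :=
    (irrChars_finite_holds (Matrix.GeneralLinearGroup (Fin 2) K)).subset Set.inter_subset_left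
  have hdeg := (stub_frameStructure K).2
  -- termwise: d^s ≤ (Q+1)^(s-2) · d^2
  have hterm : ∀ χ ∈ hfin.toFinset, (χ 1).re ^ s ≤ (Q + 1) ^ (s - 2) * (χ 1).re ^ (2 : ℝ) := by
    intro χ hχ
    obtain ⟨hirr, hmem⟩ := hfin.mem_toFinset.1 hχ
    obtain ⟨d, -, hd⟩ := IsIrrChar.exists_apply_one hirr
    have hd0 : 0 ≤ (χ 1).re := by rw [hd]; simp
    obtain ⟨c, hc⟩ := exists_coeff_of_mem_frameSpan K hmem
    have hdQ : (χ 1).re ≤ Q + 1 := hdeg χ hirr ⟨c, hc⟩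
    have hsplit : (χ 1).re ^ s = (χ 1).re ^ (s - 2) * (χ 1).re ^ (2 : ℝ) := by
      rw [← Real.rpow_add_of_nonneg hd0 (by linarith) (by norm_num)]
      congr 1; ring
    rw [hsplit]
    exact mul_le_mul_of_nonneg_right (Real.rpow_le_rpow hd0 hdQ (by linarith))
      (Real.rpow_nonneg hd0 _)
  have hsum2 : (∑ χ ∈ hfin.toFinset, (χ 1).re ^ (2 : ℝ)) ≤ (Module.finrank ℂ J : ℝ) := by
    rw [← finsum_mem_eq_finite_toFinset_sum _ hfin]
    exact stub_blockContainment (Matrix.GeneralLinearGroup (Fin 2) K) J (frameSpan_biInv K)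
  calc (∑ᶠ χ ∈ irrChars (Matrix.GeneralLinearGroup (Fin 2) K) ∩
          (J : Set (Matrix.GeneralLinearGroup (Fin 2) K → ℂ)), (χ 1).re ^ s)
        = ∑ χ ∈ hfin.toFinset, (χ 1).re ^ s := finsum_mem_eq_finite_toFinset_sum _ hfin
    _ ≤ ∑ χ ∈ hfin.toFinset, (Q + 1) ^ (s - 2) * (χ 1).re ^ (2 : ℝ) := Finset.sum_le_sum hterm
    _ = (Q + 1) ^ (s - 2) * ∑ χ ∈ hfin.toFinset, (χ 1).re ^ (2 : ℝ) := by rw [Finset.mul_sum]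
    _ ≤ (Q + 1) ^ (s - 2) * (Module.finrank ℂ J : ℝ) :=
        mul_le_mul_of_nonneg_left hsum2 (Real.rpow_nonneg (by linarith) _)
    _ ≤ (Q + 1) ^ (s - 2) * (Q ^ 3 + Q ^ 2) :=
        mul_le_mul_of_nonneg_left (finrank_frameSpan_le K) (Real.rpow_nonneg (by linarith) _)

/-- The budget in the shape the universality bookkeeping consumes: `≤ 2^s · Q^{1+s}` for `s ≥ 2`
(section form; the registered spelling is `frameBudget_le_pow` below). [folklore] -/
theorem frameBudget_le_pow_aux (s : ℝ) (hs : 2 ≤ s) :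
    (∑ᶠ χ ∈ irrChars (Matrix.GeneralLinearGroup (Fin 2) K) ∩
        ((Submodule.span ℂ {f : Matrix.GeneralLinearGroup (Fin 2) K → ℂ |
          ∃ c : (Fin 2 → K) → (Fin 2 → K) → ℂ, f = fun g : Matrix.GeneralLinearGroup (Fin 2) K =>
            ∑ u : Fin 2 → K, c u ((g : Matrix (Fin 2) (Fin 2) K).mulVec u)} :
              Submodule ℂ (Matrix.GeneralLinearGroup (Fin 2) K → ℂ)) :
          Set (Matrix.GeneralLinearGroup (Fin 2) K → ℂ)), (χ 1).re ^ s) ≤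
      (2 : ℝ) ^ s * (Fintype.card K : ℝ) ^ (1 + s) := by
  set Q : ℝ := (Fintype.card K : ℝ) with hQ
  have hQ1 : 1 ≤ Q := by
    rw [hQ]; exact_mod_cast Fintype.card_pos
  have hQ0 : 0 < Q := by linarith
  refine (frameBudget_le K s hs).trans ?_
  -- (Q+1)^(s-2) (Q³+Q²) = Q² (Q+1)^(s-1) ≤ Q² (2Q)^(s-1) = 2^(s-1) Q^(s+1) ≤ 2^s Q^(1+s)
  have h1 : (Q + 1) ^ (s - 2) * (Q ^ 3 + Q ^ 2) = Q ^ 2 * (Q + 1) ^ (s - 1) := by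
    have : (Q + 1) ^ (s - 1) = (Q + 1) ^ (s - 2) * (Q + 1) := by
      rw [← Real.rpow_add_one (by linarith : (Q + 1) ≠ 0)]; congr 1; ring
    rw [this]; ring
  have h2 : (Q + 1) ^ (s - 1) ≤ (2 : ℝ) ^ (s - 1) * Q ^ (s - 1) := by
    rw [← Real.mul_rpow (by norm_num) hQ0.le]
    exact Real.rpow_le_rpow (by linarith) (by linarith) (by linarith)
  have h3 : Q ^ 2 * Q ^ (s - 1) = Q ^ (1 + s) := by
    rw [show (Q ^ 2 : ℝ) = Q ^ (2 : ℝ) by norm_cast, ← Real.rpow_add hQ0]; congr 1; ring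
  have h4 : (2 : ℝ) ^ (s - 1) ≤ (2 : ℝ) ^ s :=
    Real.rpow_le_rpow_of_exponent_le (by norm_num) (by linarith)
  calc (Q + 1) ^ (s - 2) * (Q ^ 3 + Q ^ 2) = Q ^ 2 * (Q + 1) ^ (s - 1) := h1
    _ ≤ Q ^ 2 * ((2 : ℝ) ^ (s - 1) * Q ^ (s - 1)) := mul_le_mul_of_nonneg_left h2 (by positivity)
    _ = (2 : ℝ) ^ (s - 1) * (Q ^ 2 * Q ^ (s - 1)) := by ring
    _ = (2 : ℝ) ^ (s - 1) * Q ^ (1 + s) := by rw [h3]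
    _ ≤ (2 : ℝ) ^ s * Q ^ (1 + s) :=
        mul_le_mul_of_nonneg_right h4 (Real.rpow_nonneg hQ0.le _)

end Host

/-! ## The one-subgroup identity test (S3's form of level-one separation) -/

section OneSubgroup

variable {k K : Type} [Field k] [Fintype k] [DecidableEq k] [Field K] [Fintype K] [DecidableEq K]

/-- **One-subgroup identity test** for the image of an injective hom `φ : SL₂(k) →* GL₂(K)` and
frame functions: separators for the targets `(1, z₀)` give separators for every target `(φ a₀, z₀)`
by LEFT translation `g ↦ F_{z₀}(φ(a₀) g)`, which is again a frame function
(table `(u, v) ↦ cf u (φ(a₀) v)`). [folklore] -/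
theorem frameSeparated_image
    (φ : Matrix.SpecialLinearGroup (Fin 2) k →* Matrix.GeneralLinearGroup (Fin 2) K)
    (hφ : Function.Injective φ) (Y Z : Finset (Matrix.GeneralLinearGroup (Fin 2) K))
    (hsep : ∀ z₀ ∈ Z, ∃ cf : (Fin 2 → K) → (Fin 2 → K) → ℂ,
      ∀ a : Matrix.SpecialLinearGroup (Fin 2) k, ∀ y ∈ Y, ∀ y' ∈ Y, ∀ z ∈ Z,
        (∑ u : Fin 2 → K, cf u (((φ a * y * y'⁻¹ * z : Matrix.GeneralLinearGroup (Fin 2) K) :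
            Matrix (Fin 2) (Fin 2) K).mulVec u)) =
          if a = 1 ∧ y = y' ∧ z = z₀ then 1 else 0) :
    ∀ x₀ ∈ Finset.univ.image φ, ∀ z₀ ∈ Z, ∃ c : (Fin 2 → K) → (Fin 2 → K) → ℂ,
      ∀ x ∈ Finset.univ.image φ, ∀ y ∈ Y, ∀ y' ∈ Y, ∀ z ∈ Z,
        (∑ u : Fin 2 → K, c u (((x⁻¹ * y * y'⁻¹ * z : Matrix.GeneralLinearGroup (Fin 2) K) :
            Matrix (Fin 2) (Fin 2) K).mulVec u)) =
          if x = x₀ ∧ y = y' ∧ z = z₀ then 1 else 0 := by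
  intro x₀ hx₀ z₀ hz₀
  obtain ⟨a₀, -, rfl⟩ := Finset.mem_image.1 hx₀
  obtain ⟨cf, hcf⟩ := hsep z₀ hz₀
  refine ⟨fun u v => cf u ((φ a₀ : Matrix (Fin 2) (Fin 2) K).mulVec v),
    fun x hx y hy y' hy' z hz => ?_⟩
  obtain ⟨a, -, rfl⟩ := Finset.mem_image.1 hx
  have hg : φ a₀ * ((φ a)⁻¹ * y * y'⁻¹ * z) = φ (a₀ * a⁻¹) * y * y'⁻¹ * z := by
    rw [map_mul, map_inv]; simp only [mul_assoc]
  have h1 : (∑ u : Fin 2 → K, (fun u v => cf u ((φ a₀ : Matrix (Fin 2) (Fin 2) K).mulVec v)) u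
      ((((φ a)⁻¹ * y * y'⁻¹ * z : Matrix.GeneralLinearGroup (Fin 2) K) :
        Matrix (Fin 2) (Fin 2) K).mulVec u)) =
      ∑ u : Fin 2 → K, cf u (((φ (a₀ * a⁻¹) * y * y'⁻¹ * z :
        Matrix.GeneralLinearGroup (Fin 2) K) : Matrix (Fin 2) (Fin 2) K).mulVec u) := by
    refine Finset.sum_congr rfl fun u _ => ?_
    dsimp only
    rw [Matrix.mulVec_mulVec, ← Units.val_mul, hg]
  rw [h1, hcf (a₀ * a⁻¹) y hy y' hy' z hz]
  by_cases h : φ a = φ a₀ ∧ y = y' ∧ z = z₀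
  · rw [if_pos h, if_pos ⟨mul_inv_eq_one.2 (hφ h.1).symm, h.2⟩]
  · rw [if_neg h, if_neg fun h' => h ⟨(congrArg φ (mul_inv_eq_one.1 h'.1)).symm, h'.2⟩]

end OneSubgroup

/-- **The level-one budget of `GL₂(K)` over ANY finite field** (registered stub of the crux, lead c5):
`Σ_{χ ∈ Irr(GL₂ K) ∩ F₁(K)} χ(1)^s ≤ 2^s · |K|^{1+s}` for every real `s ≥ 2`, where `F₁(K)` is the span
of the frame functions — from the landed S1 (`stub_blockContainment`) and S2 (`stub_frameStructure`).
[cite: BlasiakCohnGrochowPrattUmans2024, Def 2.1] -/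
theorem frameBudget_le_pow (K : Type) [Field K] [Fintype K] [DecidableEq K] (s : ℝ) (hs : 2 ≤ s) :
    (∑ᶠ χ ∈ Literature.RepresentationTheory.FiniteGroups.irrChars (Matrix.GeneralLinearGroup (Fin 2) K) ∩
      ((Submodule.span ℂ {f : Matrix.GeneralLinearGroup (Fin 2) K → ℂ |
        ∃ c : (Fin 2 → K) → (Fin 2 → K) → ℂ, f = fun g : Matrix.GeneralLinearGroup (Fin 2) K =>
          ∑ u : Fin 2 → K, c u ((g : Matrix (Fin 2) (Fin 2) K).mulVec u)} :
            Submodule ℂ (Matrix.GeneralLinearGroup (Fin 2) K → ℂ)) :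
        Set (Matrix.GeneralLinearGroup (Fin 2) K → ℂ)), (χ 1).re ^ s) ≤
      (2 : ℝ) ^ s * (Fintype.card K : ℝ) ^ (1 + s) :=
  frameBudget_le_pow_aux K s hs

end SubfieldCell

end Summit.MatrixMultiplication.MatrixMultiplication.Theorems.GradedDesignFamily

end
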